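import Summits.AtomisticToContinuum.Crystallization.Theorems.FrustratedLawDichotomyStrainedPatchHomValueT2KitL
import Summits.AtomisticToContinuum.Crystallization.Theorems.FrustratedLawDichotomyStrainedPatchHomValueT2SoundJ
import Summits.AtomisticToContinuum.Crystallization.Theorems.FrustratedLawDichotomyStrainedPatchHomValueT2SoundB

/-!
# (I1) part K — the per-label DERIVATIVE TABLES of the second-edition kit enclose the real folded derivatives (roadmap R3b, first half):
# `Array.ofFn/getD` plumbing, `d1 ∋ dyR` (first derivatives of `y = Vq`), `d2 = ddyR` (mixed second derivatives, exact integers), and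
# `zetaN = Σ_c y_c·dyR` (27623 `(H) HomFloor`, hcp half; decomp-a2c hand-1 g41; I1-ROADMAP-g41 §4 (iii)).

No definitions; 0 sorry; standard axioms; no instances / notation / `#eval`.  `--supports stmt-AtomisticToContinuum-27623`.
-/

noncomputable section

namespace Summit.AtomisticToContinuum.Crystallization.Theorems.FrustratedLawDichotomyStrainedPatchHomValueT2Kit

open scoped BigOperators RealInnerProductSpace
open Finset
open Literature.Analysis.ValidatedNumerics.Numerics
open Summit.AtomisticToContinuum.Crystallization.Theorems.ChargedEnergyGapNegative (E3)

/-! ## §1. Array plumbing -/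

/-- Reading an `Array.ofFn` inside its range. [formal bookkeeping] -/
theorem getD_ofFn_lt {α : Type*} {n : ℕ} (f : Fin n → α) (d : α) {i : ℕ} (h : i < n) : (Array.ofFn f).getD i d = f ⟨i, h⟩ := by
  simp [Array.getD, h]

/-- Reading an `Array.ofFn` outside its range gives the default. [formal bookkeeping] -/
theorem getD_ofFn_ge {α : Type*} {n : ℕ} (f : Fin n → α) (d : α) {i : ℕ} (h : n ≤ i) : (Array.ofFn f).getD i d = d := by
  simp [Array.getD, not_lt.2 h]

/-! ## §2. `d1 ∋ dyR` -/

/-- The `memU` fold of `d1` encloses the corresponding real sum. [formal bookkeeping] -/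
theorem mem_fold_memU {q : E3} {qt : Fin 3 → FI} (hq : ∀ c, FI.mem (q c) (qt c)) (cc : Fin 3) (L : List (Fin 3 × Fin 3)) :
    FI.mem ((L.map fun cd => if cd.1 = cc then q cd.2 else 0).sum)
      (L.foldl (fun s cd => if cd.1 = cc then s.add (qt cd.2) else s) fi0) := by
  -- generalise the accumulator
  suffices h : ∀ (acc : FI) (x : ℝ), FI.mem x acc →
      FI.mem (x + (L.map fun cd => if cd.1 = cc then q cd.2 else 0).sum) (L.foldl (fun s cd => if cd.1 = cc then s.add (qt cd.2) else s) acc) by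
    simpa using h fi0 0 mem_fi0
  induction L with
  | nil => intro acc x hx; simpa using hx
  | cons cd L ih =>
    intro acc x hx
    simp only [List.map_cons, List.sum_cons, List.foldl_cons]
    by_cases hc : cd.1 = cc
    · rw [if_pos hc, if_pos hc, ← add_assoc]
      exact ih _ _ (FI.mem_add hx (hq cd.2))
    · rw [if_neg hc, if_neg hc, zero_add]
      exact ih _ _ hx

/-- The `U`-part of `dyR` is the `memU` sum. [formal bookkeeping] -/
theorem dyR_eq_memU_sum (V : E3 →L[ℝ] E3) (q : E3) {a : ℕ} (ha : a < 6) (cc : Fin 3) :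
    dyR V q a cc = ((memU a).map fun cd => if cd.1 = cc then q cd.2 else 0).sum := by
  interval_cases a <;> fin_cases cc <;> simp [dyR, memU]

/-- ★ **`d1` encloses `dyR`** for every coordinate `a < 9`. [folklore] -/
theorem mem_d1 (V : E3 →L[ℝ] E3) (q : E3) {E : Fin 3 × Fin 3 → FI} {qt : Fin 3 → FI}
    (hE : ∀ ab : Fin 3 × Fin 3, FI.mem ((V (EuclideanSpace.single ab.2 (1 : ℝ))) ab.1) (E ab)) (hq : ∀ c, FI.mem (q c) (qt c))
    {a : ℕ} (ha : a < 9) (cc : Fin 3) : FI.mem (dyR V q a cc) (d1 E qt a cc) := by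
  by_cases h6 : a < 6
  · rw [dyR_eq_memU_sum V q h6 cc]
    unfold d1; rw [if_pos h6]
    exact mem_fold_memU hq cc (memU a)
  · have h9 : a - 6 < 3 := by omega
    unfold d1; rw [if_neg h6, dif_pos h9]
    have key : dyR V q a cc = ent V cc ⟨a - 6, h9⟩ := by
      interval_cases a <;> simp [dyR]
    rw [key]
    exact hE (cc, ⟨a - 6, h9⟩)

/-! ## §3. `d2 = ddyR` -/

/-- ★ **The kit's mixed second derivatives are the real ones** (exact integers). [formal bookkeeping] -/
theorem d2_cast {a b : ℕ} (ha : a < 9) (hb : b < 9) (cc : Fin 3) : ((d2 a b cc : ℤ) : ℝ) = ddyR a b cc := by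
  interval_cases a <;> interval_cases b <;> fin_cases cc <;> simp [d2, ddyR, ddyU, memU]

/-! ## §4. `ζ` as a component sum -/

/-- ★ `zetaN V q k = Σ_c (Vq)_c · dyR V q k c` (`k < 9`). [arithmetic] -/
theorem zetaN_eq_sum (V : E3 →L[ℝ] E3) (q : E3) {k : ℕ} (hk : k < 9) :
    zetaN V q k = ∑ cc : Fin 3, (V q) cc * dyR V q k cc := by
  interval_cases k <;> simp [zetaN, dyR, Fin.sum_univ_three] <;> ring

/-- `nuR` is symmetric. [arithmetic] -/
theorem nuR_symm (V : E3 →L[ℝ] E3) (q : E3) (k l : ℕ) : nuR V q k l = nuR V q l k := by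
  unfold nuR
  refine Finset.sum_congr rfl fun cc _ => ?_
  have : ddyR k l cc = ddyR l k cc := by
    unfold ddyR
    by_cases h1 : k < 6 ∧ 6 ≤ l ∧ l < 9
    · have h2 : ¬ (l < 6 ∧ 6 ≤ k ∧ k < 9) := by omega
      rw [if_pos h1, if_neg h2, if_pos h1]
    · rw [if_neg h1]
      by_cases h2 : l < 6 ∧ 6 ≤ k ∧ k < 9
      · rw [if_pos h2, if_pos h2]
      · rw [if_neg h2, if_neg h2, if_neg h1]
  rw [this]; ring

end Summit.AtomisticToContinuum.Crystallization.Theorems.FrustratedLawDichotomyStrainedPatchHomValueT2Kit
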